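import Literature.AnabelianGeometry.EtaleTheta.Discharge.Sec5Lem59ivOfThetaSetting
import Literature.AnabelianGeometry.EtaleTheta.Discharge.Sec5KummerOutCanonical

/-!
# [EtTh] §5, the `envIso`-chain nodes RE-CLOSED at the Ÿ̲̲-junction data of a theta setting: Lemma 5.8 («constants act through
# `μ_N(B_N)`», `constOut ↦ D_Y`), Lemma 5.9 (iii) (the `l·ℤ`-part of `D` ↦ the `Gal(Y/X)`-part of `D_Y`), Prop. 5.2 (iii)
# (`[Im s^⊔-Π_N] ↦ [Im s^Θ_Ÿ]`) — every refuted-closure FACT binder supplied BY NAME (pp. 324, 331–332 / PDF pp. 98, 105–106)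

S. Mochizuki, *The étale theta function and its Frobenioid-theoretic manifestations*, Publ. RIMS **45** (2009) [EtTh], Lemma 5.8 p. 331
(PDF p. 105), Lemma 5.9 (iii)/(iv) p. 332 (PDF p. 106), Prop. 5.2 (iii) p. 324 (PDF p. 98) [cite: MochizukiEtTh2009, Lem 5.8 p.331 (PDF p.105)]
[cite: MochizukiEtTh2009, Lem 5.9 (iii) p.332 (PDF p.106)] [cite: MochizukiEtTh2009, Prop 5.2 (iii) p.324 (PDF p.98)].

abc-iut cell, layer L2, seat abc-iut-w6-d053 (gen 6); K4 / C-R33 rows of abc-iut-c312-2's CONE-K4-RECLOSE.tsv v5: 28 `EtTh:Lem5.8` (F-0533, F-0534,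
F-0536, F-1306, F-1307, F-2494 at abc-iut-L2-t11's `conj_comm_mem_muTorsion` / `envIso_conj_const` / `isEnvCocycle_of_inflated` /
`image_constOut_subset_DY` / `constOutTransported_preimage`), 31 `EtTh:Lem5.9(iii)` (F-0533, F-0738, F-1306, F-1307, F-2494 at `envIso_conj_liftPi` /
`image_galOut` / `IsEnvCompatible.transport_galOut`), 43 `EtTh:Prop5.2(iii)` (12 rows at `map_range_sCupPi` / `map_sTheta_eq` / …); rows 29/30
`EtTh:Lem5.9(i)`/`(ii)` need no new Lean (their re-keyed closers are this base's gen-5 `sectionsFactor_ofThetaSettingYddData` /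
`enExact_ofThetaSettingYddData`, p462478).  PROOF-ONLY (0 definitions, 0 instances, 0 new `Prop`; nothing landed is edited or restated): every
theorem is a composition of LANDED theorems read at abc-iut-L2-t4's junction `𝔉 := ofThetaSettingData μ hC hS h Q R K' constEmb … hinvc hinvp` over
`BiKummerSetting.mkOfThetaSettingYdd C e μ hC hS tf hZ hP NH` (`Π^tp_X̲̲ := C.Huu`, `A_⊙^bs := Ÿ̲̲`), `T := C.thetaEnvData μ hC hS` (abc-iut-L2-t8), `ι := id`,
with the binders supplied as in this seat's `Discharge/Sec5Lem59ivNode.lean` (p467740): `H : Facts` (F-2494) ⟸ {`hconst`, `hD`}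
(`facts_ofThetaSettingYddData_of_constantsDictionary`, p440765); `hsec`/`hcs`/`h1`/`h8` (F-0738/F-0543/F-0542/F-0536) as its projections;
`h3` (F-0539) := `outerActionLZ_of`; `hY`/`hYdd` (F-0533/F-0519) := `identifiesPiY_ofThetaSettingData` / `identifiesPiYdd_ofThetaSettingData'` (rfl at
`ι := id`); `hχX`/`hχ` (F-1306/F-1307) := abc-iut-L2-t11's `ConstantsDictionary.cyclotomicCharacterCompatX` (p439828) ⟸ `hD`; `hu : ActsByCyclotome u`
(F-0534) := `Facts.constantsActByCyclotome` for `u ∈ (O_K^×)^{1/N}`; the constants' inflation input `hinflAll` (Lemma 5.8's arithmetic) ⟸ `hD` via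
abc-iut-L2-t11's `hinflAll_of_hinfl` ∘ `hinfl_of_geometric` ∘ `ConstantsDictionary.hgeom` («`Δ^tp_Y` fixes the `N`-th roots of constants»);
`hcompat` (F-0521) := abc-iut-f-125 / f-116's SOLVED FORM `thetaSectionCompat_ofThetaSettingData_transport` for the transported bi-Kummer difference
cocycle, leaving the Prop. 5.2 (iii) ORIGIN CLAUSE `hΘ` (GAP G-L2t4-2) — or kept in its surviving instance form.

WHAT THIS FILE DISPLAYS (residual EXACTLY {junction data, `hconst` (Def. 3.6 (iii)), the ONE dictionary binder `hD`, a cyclotome reading `m`}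
unless a theorem says more):
* Lemma 5.8 — `conj_comm_mem_muTorsion_ofThetaSettingYdd` (for `u ∈ (O_K^×)^{1/N}` and `y ∈ Π^tp_Y̲̲`, the commutator
  `u · s^⊓-gp_N(ρ y) · u⁻¹ · s^⊓-gp_N(ρ y)⁻¹ ∈ μ_N(B_N)` — "acts via multiplication by an element of `μ_N(B_N)`"), and
  `image_constOut_subset_DY_ofThetaSettingYdd` (**`constOut ↦ D_Y`**: the transported outer action of the constants `(O_K^×)^{1/N}/μ_N(B_N) ⥲ O_K^×`
  on `E^Π_N` lies in `D_Y`);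
* Lemma 5.9 (iii) — `envIso_conj_liftPi_ofThetaSettingYdd` (elementwise: conjugation by `(s^⊓-gp_N(ρ g), g)` on `E^Π_N` becomes `conjX g` on
  `Π^tp_Y̲̲[μ_N]`) and `image_galOut_ofThetaSettingYdd` (**the `l·ℤ`-part of `D` is carried ONTO the `Gal(Y/X)`-part of `D_Y`**);
* Prop. 5.2 (iii) — `map_sTheta_eq_ofThetaSettingYdd_of_originClause` (**`[Im s^⊔-Π_N] ↦ [Im s^Θ_Ÿ]`** at the level of `μ_N`-conjugacy classes, for
  the theta section of the transported bi-Kummer difference cocycle, modulo the origin clause `hΘ`) and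
  `map_range_sCupPi_ofThetaSettingYdd_of_thetaSectionCompat` (the range statement for ANY cocycle `η` of the collection in F-0521's surviving
  instance form `hcompat`).
HONEST FRAMING: kernel re-keying of landed theorems at the typed junction; `tf` (a tempered Frobenioid over `B^temp(Π^tp_X̲̲)⁰`) is an abstract
parameter, not inhabited for an actual curve; the dictionary `hD` is a hypothesis; FACT rows are assumption LABELS (universal closures refuted,
instance forms = the theorems named); nothing of [EtTh] is asserted unconditionally; no side is taken on [IUTchIII] Cor. 3.12 or any author;
typed ≠ proved.
-/

noncomputable section

namespace Literature.AnabelianGeometry.EtaleTheta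

open CategoryTheory Opposite Literature.AlgebraicGeometry.Frobenioids Literature.AnabelianGeometry.SemiGraphs
  Literature.AnabelianGeometry.SemiGraphs.GaloisObjects Literature.AlgebraicGeometry.Frobenioids.QuasiTemperoid.BTempConnected
open scoped Pointwise

universe v₀

namespace ThetaFrobenioid

section EnvIsoChain

variable {p : ℕ} [Fact p.Prime] {D : ThetaSetting p} {E : D.EtaleThetaData} {l : ℕ} {C : E.DoubleUnderline l}
  {e : D.toTemperedCurve.GroupLevelData} {N : ℕ+} (μ : D.CyclotomeMod l N) (hC : D.Compat) (hS : D.Sec2Hyps)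
  {D₀ : Type} [Category.{v₀} D₀] {V : FrdIMonoidStub.{0}} {T₀ : RealifiedDivisorMonoids (D₀ := D₀) V}
  {VD : FrdICatStub.{1, 0, 0} (ConnectedPart (BTemp (C.temperedArithmeticGroup e).Pi))}
  {tf : TemperedFrobenioid T₀ (ConnectedPart (BTemp (C.temperedArithmeticGroup e).Pi)) VD} {hZ : tf.monoidType = MonoidType.Z}
  {hP : ∀ A : (ConnectedPart (BTemp (C.temperedArithmeticGroup e).Pi))ᵒᵖ, IsPerfect (tf.Φ.carrier A)}
  {NH : Subgroup (Field.absoluteGaloisGroup D.K) → tf.category → ℕ+ → Prop}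
  {pullFrac : ∀ {A A' : (BiKummerSetting.mkOfThetaSettingYdd C e μ hC hS tf hZ hP NH).C} (_ : A' ⟶ A),
    (BiKummerSetting.mkOfThetaSettingYdd C e μ hC hS tf hZ hP NH).biratUnits A →
      (BiKummerSetting.mkOfThetaSettingYdd C e μ hC hS tf hZ hP NH).biratUnits A'}
  {θ : (BiKummerSetting.mkOfThetaSettingYdd C e μ hC hS tf hZ hP NH).biratUnits (BiKummerSetting.mkOfThetaSettingYdd C e μ hC hS tf hZ hP NH).Aodot}
  {Bl : (BiKummerSetting.mkOfThetaSettingYdd C e μ hC hS tf hZ hP NH).C}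
  {Pl : (BiKummerSetting.mkOfThetaSettingYdd C e μ hC hS tf hZ hP NH).FractionPair θ Bl}
  {Rl : (BiKummerSetting.mkOfThetaSettingYdd C e μ hC hS tf hZ hP NH).NthRoot θ Pl C.lPNat pullFrac}
  (h : ModelFrobenioid.Hypotheses tf.divisorMonoid tf.ratFnFunctor)
  (Q : FrobenioidTheta.ThetaSubquotientStub.{0} (ConnectedPart (BTemp (C.temperedArithmeticGroup e).Pi)))
  (R : (BiKummerSetting.mkOfThetaSettingYdd C e μ hC hS tf hZ hP NH).NthRoot Rl.root Rl.pair N pullFrac)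
  (K' : Type) [Field K'] (constEmb : K'ˣ →* tf.biratUnitsModel R.BN) (constEmb_injective : Function.Injective constEmb)
  (hinvc : ∀ g : Aut R.AN.base,
    pull tf.divisorMonoid g.hom (ModelFrobenioid.div R.pair.num) = ModelFrobenioid.div R.pair.num)
  (hinvp : ∀ y : (C.thetaEnvData μ hC hS).PiX, y ∈ (C.thetaEnvData μ hC hS).PiYdd →
    pull tf.divisorMonoid ((BiKummerSetting.mkOfThetaSettingYdd C e μ hC hS tf hZ hP NH).galoisSurj
      R.AN.base R.αData.isGalois ((ContinuousMulEquiv.refl _) y)).hom (ModelFrobenioid.div R.pair.den) = ModelFrobenioid.div R.pair.den)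
  (hconst : ∀ (ε : Aut R.BN) (k : K'ˣ), tf.biratAutModel R.BN ε (constEmb k) = constEmb k)
  (m : (ofThetaSettingData μ hC hS h Q R K' constEmb constEmb_injective hinvc hinvp).muTorsion
      (ofThetaSettingData μ hC hS h Q R K' constEmb constEmb_injective hinvc hinvp).BN N ≃* (C.thetaEnvData μ hC hS).mu)
  {Cst : Subgroup ((ofThetaSettingData μ hC hS h Q R K' constEmb constEmb_injective hinvc hinvp).biratUnits
      (ofThetaSettingData μ hC hS h Q R K' constEmb constEmb_injective hinvc hinvp).BN)}
  {ν' : Cst →* (PadicAlgCl p)ˣ}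
  (hD : BiratAutAction.ConstantsDictionary
    (biratAutAction_ofConnectedTemperoidData (T := C.thetaEnvData μ hC hS) h Q C.odd_lPNat R (ContinuousMulEquiv.refl _) K' constEmb
      constEmb_injective hinvc hinvp hconst) C μ hC hS (ContinuousMulEquiv.refl _) m Cst ν')

include hD

/-! ### Lemma 5.8 -/

/-- **Lemma 5.8 at the Ÿ̲̲-junction data: the constants act through `μ_N(B_N)`** — for `u ∈ (O_K^×)^{1/N}` and `y ∈ Π^tp_Y̲̲`, the
commutator `u · s^⊓-gp_N(ρ y) · u⁻¹ · s^⊓-gp_N(ρ y)⁻¹` lies in `μ_N(B_N)` ("the set of elements [of `O^×(B_N)`] on which `Π^tp_Y` acts via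
multiplication by an element of `μ_N(B_N)` … coincide[s] with `(O_K^×)^{1/N}`", proof of Lemma 5.8): abc-iut-L2-t11's
`conj_comm_mem_muTorsion` with its F-0534 binder `hu : ActsByCyclotome u` SUPPLIED by `Facts.constantsActByCyclotome` (`Facts` ⟸ {`hconst`, `hD`}).
[cite: MochizukiEtTh2009, Lem 5.8 proof p.331 (PDF p.105)] -/
theorem conj_comm_mem_muTorsion_ofThetaSettingYdd
    {u : Aut (ofThetaSettingData μ hC hS h Q R K' constEmb constEmb_injective hinvc hinvp).BN}
    (hu₀ : u ∈ (ofThetaSettingData μ hC hS h Q R K' constEmb constEmb_injective hinvc hinvp).OKxRootN)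
    {y : (ofThetaSettingData μ hC hS h Q R K' constEmb constEmb_injective hinvc hinvp).PiX}
    (hy : y ∈ (ofThetaSettingData μ hC hS h Q R K' constEmb constEmb_injective hinvc hinvp).PiY) :
    u * (ofThetaSettingData μ hC hS h Q R K' constEmb constEmb_injective hinvc hinvp).sgpCap
          ((ofThetaSettingData μ hC hS h Q R K' constEmb constEmb_injective hinvc hinvp).ρ y) * u⁻¹ *
        ((ofThetaSettingData μ hC hS h Q R K' constEmb constEmb_injective hinvc hinvp).sgpCap
          ((ofThetaSettingData μ hC hS h Q R K' constEmb constEmb_injective hinvc hinvp).ρ y))⁻¹ ∈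
      (ofThetaSettingData μ hC hS h Q R K' constEmb constEmb_injective hinvc hinvp).muTorsion
        (ofThetaSettingData μ hC hS h Q R K' constEmb constEmb_injective hinvc hinvp).BN N :=
  (ofThetaSettingData μ hC hS h Q R K' constEmb constEmb_injective hinvc hinvp).conj_comm_mem_muTorsion
    (((facts_ofThetaSettingYddData_of_constantsDictionary (hD' := hD)).constantsActByCyclotome u).mp hu₀).2 hy

/-- **Lemma 5.8 / 5.9 (iv) at the Ÿ̲̲-junction data: `constOut ↦ D_Y`** — the transported outer action of the constants
`(O_K^×)^{1/N}/μ_N(B_N) (⥲ O_K^×)` on `E^Π_N` lies in `D_Y ⊆ Out(Π^tp_Y̲̲[μ_N])`: abc-iut-L2-t11's `image_constOut_subset_DY` with `H`, `h8`,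
`hY`, `hχ` supplied as above and the constants' inflation input `hinflAll` (Lemma 5.8's arithmetic: the Kummer class of each `u ∈ (O_K^×)^{1/N}`
is inflated from `G_K`) DERIVED from the dictionary `hD` through abc-iut-L2-t11's `hinflAll_of_hinfl` ∘ `hinfl_of_geometric` ∘
`ConstantsDictionary.hgeom`.  [cite: MochizukiEtTh2009, Lem 5.8 p.331 (PDF p.105); Lem 5.9 (iv) p.332 (PDF p.106)] -/
theorem image_constOut_subset_DY_ofThetaSettingYdd :
    TopOut.transport
        ((ofThetaSettingData μ hC hS h Q R K' constEmb constEmb_injective hinvc hinvp).envContIso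
          (facts_ofThetaSettingYddData_of_constantsDictionary (hD' := hD)) (C.thetaEnvData μ hC hS) (ContinuousMulEquiv.refl _) m
          (identifiesPiY_ofThetaSettingData μ hC hS h Q R K' constEmb constEmb_injective hinvc hinvp)
          (hD.cyclotomicCharacterCompatX
            (kxRootNModCyclotome_ofThetaSettingData_of_constantsDictionary μ hC hS h Q R K' constEmb constEmb_injective hinvc hinvp
              hconst m hD)).toY) ''
      (ofThetaSettingData μ hC hS h Q R K' constEmb constEmb_injective hinvc hinvp).constOut
        (facts_ofThetaSettingYddData_of_constantsDictionary (hD' := hD)).constantsEqNormalizer ⊆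
      ((C.thetaEnvData μ hC hS).DY : Set (TopOut (C.thetaEnvData μ hC hS).env)) :=
  (ofThetaSettingData μ hC hS h Q R K' constEmb constEmb_injective hinvc hinvp).image_constOut_subset_DY
    (facts_ofThetaSettingYddData_of_constantsDictionary (hD' := hD)) (C.thetaEnvData μ hC hS) (ContinuousMulEquiv.refl _) m
    (identifiesPiY_ofThetaSettingData μ hC hS h Q R K' constEmb constEmb_injective hinvc hinvp)
    (hD.cyclotomicCharacterCompatX
      (kxRootNModCyclotome_ofThetaSettingData_of_constantsDictionary μ hC hS h Q R K' constEmb constEmb_injective hinvc hinvp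
        hconst m hD)).toY
    (facts_ofThetaSettingYddData_of_constantsDictionary (hD' := hD)).constantsEqNormalizer
    ((biratAutAction_ofConnectedTemperoidData (T := C.thetaEnvData μ hC hS) h Q C.odd_lPNat R (ContinuousMulEquiv.refl _) K' constEmb
        constEmb_injective hinvc hinvp hconst).hinflAll_of_hinfl
      (kxRootNModCyclotome_ofThetaSettingData_of_constantsDictionary μ hC hS h Q R K' constEmb constEmb_injective hinvc hinvp hconst m hD)
      (C.thetaEnvData μ hC hS) (ContinuousMulEquiv.refl _) m
      ((biratAutAction_ofConnectedTemperoidData (T := C.thetaEnvData μ hC hS) h Q C.odd_lPNat R (ContinuousMulEquiv.refl _) K' constEmb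
          constEmb_injective hinvc hinvp hconst).hinfl_of_geometric
        (kxRootNModCyclotome_ofThetaSettingData_of_constantsDictionary μ hC hS h Q R K' constEmb constEmb_injective hinvc hinvp hconst m hD)
        (C.thetaEnvData μ hC hS) (ContinuousMulEquiv.refl _) m
        (hD.hgeom
          (kxRootNModCyclotome_ofThetaSettingData_of_constantsDictionary μ hC hS h Q R K' constEmb constEmb_injective hinvc hinvp
            hconst m hD))))

/-! ### Lemma 5.9 (iii) -/

/-- **Lemma 5.9 (iii) at the Ÿ̲̲-junction data, elementwise**: under `E^Π_N ⥲ Π^tp_Y̲̲[μ_N]`, conjugation by `(s^⊓-gp_N(ρ g), g)` on `E^Π_N`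
(the natural outer action of `l·ℤ ≅ Π^tp_X̲̲/Π^tp_Y̲̲`) is abc-iut-L2-t2's `conjX g` — abc-iut-L2-t11's `envIso_conj_liftPi` with `H`, `hY`,
`hχ`, `hχX`, `h3`, `hsec` supplied BY NAME.  [cite: MochizukiEtTh2009, Lem 5.9 (iii) p.332 (PDF p.106)] -/
theorem envIso_conj_liftPi_ofThetaSettingYdd
    (g : (ofThetaSettingData μ hC hS h Q R K' constEmb constEmb_injective hinvc hinvp).PiX)
    (x : (ofThetaSettingData μ hC hS h Q R K' constEmb constEmb_injective hinvc hinvp).EPiN) :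
    (ofThetaSettingData μ hC hS h Q R K' constEmb constEmb_injective hinvc hinvp).envIso
        (facts_ofThetaSettingYddData_of_constantsDictionary (hD' := hD)) (C.thetaEnvData μ hC hS)
        (ContinuousMulEquiv.refl _).toMulEquiv m
        (identifiesPiY_ofThetaSettingData μ hC hS h Q R K' constEmb constEmb_injective hinvc hinvp)
        (hD.cyclotomicCharacterCompatX
          (kxRootNModCyclotome_ofThetaSettingData_of_constantsDictionary μ hC hS h Q R K' constEmb constEmb_injective hinvc hinvp
            hconst m hD)).toY
        ((ofThetaSettingData μ hC hS h Q R K' constEmb constEmb_injective hinvc hinvp).EPiN.normalizerMonoidHom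
          ⟨(ofThetaSettingData μ hC hS h Q R K' constEmb constEmb_injective hinvc hinvp).liftPi g,
            (ofThetaSettingData μ hC hS h Q R K' constEmb constEmb_injective hinvc hinvp).liftPi_mem_normalizer
              (ofThetaSettingData μ hC hS h Q R K' constEmb constEmb_injective hinvc hinvp).outerActionLZ_of
              (facts_ofThetaSettingYddData_of_constantsDictionary (hD' := hD)).sgpCapSection g⟩ x) =
      (C.thetaEnvData μ hC hS).conjX ((ContinuousMulEquiv.refl _).toMulEquiv g)
        ((ofThetaSettingData μ hC hS h Q R K' constEmb constEmb_injective hinvc hinvp).envIso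
          (facts_ofThetaSettingYddData_of_constantsDictionary (hD' := hD)) (C.thetaEnvData μ hC hS)
          (ContinuousMulEquiv.refl _).toMulEquiv m
          (identifiesPiY_ofThetaSettingData μ hC hS h Q R K' constEmb constEmb_injective hinvc hinvp)
          (hD.cyclotomicCharacterCompatX
            (kxRootNModCyclotome_ofThetaSettingData_of_constantsDictionary μ hC hS h Q R K' constEmb constEmb_injective hinvc hinvp
              hconst m hD)).toY x) :=
  (ofThetaSettingData μ hC hS h Q R K' constEmb constEmb_injective hinvc hinvp).envIso_conj_liftPi
    (facts_ofThetaSettingYddData_of_constantsDictionary (hD' := hD)) (C.thetaEnvData μ hC hS) (ContinuousMulEquiv.refl _).toMulEquiv m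
    (identifiesPiY_ofThetaSettingData μ hC hS h Q R K' constEmb constEmb_injective hinvc hinvp)
    (hD.cyclotomicCharacterCompatX
      (kxRootNModCyclotome_ofThetaSettingData_of_constantsDictionary μ hC hS h Q R K' constEmb constEmb_injective hinvc hinvp
        hconst m hD)).toY
    (hD.cyclotomicCharacterCompatX
      (kxRootNModCyclotome_ofThetaSettingData_of_constantsDictionary μ hC hS h Q R K' constEmb constEmb_injective hinvc hinvp
        hconst m hD))
    (ofThetaSettingData μ hC hS h Q R K' constEmb constEmb_injective hinvc hinvp).outerActionLZ_of
    (facts_ofThetaSettingYddData_of_constantsDictionary (hD' := hD)).sgpCapSection g x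

/-- **Lemma 5.9 (iii) / (iv) at the Ÿ̲̲-junction data: the `l·ℤ`-part of `D` is carried ONTO the `Gal(Y/X)`-part of `D_Y`** — transport along
`E^Π_N ≃ₜ* Π^tp_Y̲̲[μ_N]` maps abc-iut-L2-t4's `galOut` (the natural outer action of `l·ℤ` on `E^Π_N`) onto abc-iut-L2-t2's `ThetaEnvData.galOut`:
abc-iut-L2-t11's `image_galOut` with `H`, `h3`, `hsec`, `hY`, `hχX` supplied BY NAME.  [cite: MochizukiEtTh2009, Lem 5.9 (iii) p.332 (PDF p.106)] -/
theorem image_galOut_ofThetaSettingYdd :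
    TopOut.transport
        ((ofThetaSettingData μ hC hS h Q R K' constEmb constEmb_injective hinvc hinvp).envContIso
          (facts_ofThetaSettingYddData_of_constantsDictionary (hD' := hD)) (C.thetaEnvData μ hC hS) (ContinuousMulEquiv.refl _) m
          (identifiesPiY_ofThetaSettingData μ hC hS h Q R K' constEmb constEmb_injective hinvc hinvp)
          (hD.cyclotomicCharacterCompatX
            (kxRootNModCyclotome_ofThetaSettingData_of_constantsDictionary μ hC hS h Q R K' constEmb constEmb_injective hinvc hinvp
              hconst m hD)).toY) ''
      (ofThetaSettingData μ hC hS h Q R K' constEmb constEmb_injective hinvc hinvp).galOut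
        (ofThetaSettingData μ hC hS h Q R K' constEmb constEmb_injective hinvc hinvp).outerActionLZ_of
        (facts_ofThetaSettingYddData_of_constantsDictionary (hD' := hD)).sgpCapSection =
      (C.thetaEnvData μ hC hS).galOut :=
  (ofThetaSettingData μ hC hS h Q R K' constEmb constEmb_injective hinvc hinvp).image_galOut
    (facts_ofThetaSettingYddData_of_constantsDictionary (hD' := hD))
    (ofThetaSettingData μ hC hS h Q R K' constEmb constEmb_injective hinvc hinvp).outerActionLZ_of
    (facts_ofThetaSettingYddData_of_constantsDictionary (hD' := hD)).sgpCapSection (C.thetaEnvData μ hC hS) (ContinuousMulEquiv.refl _) m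
    (identifiesPiY_ofThetaSettingData μ hC hS h Q R K' constEmb constEmb_injective hinvc hinvp)
    (hD.cyclotomicCharacterCompatX
      (kxRootNModCyclotome_ofThetaSettingData_of_constantsDictionary μ hC hS h Q R K' constEmb constEmb_injective hinvc hinvp
        hconst m hD))

/-! ### Proposition 5.2 (iii): `[Im s^⊔-Π_N] ↦ [Im s^Θ_Ÿ]` -/

/-- **Prop. 5.2 (iii) / Lemma 5.9 (iv) at the Ÿ̲̲-junction data, range form, F-0521 in its surviving INSTANCE FORM**: for ANY cocycle `η` of the
collection satisfying the Prop. 5.2 (iii) dictionary `hcompat` against the DERIVED `Facts`, the image of `Im(s^⊔-Π_N)` under `E^Π_N ⥲ Π^tp_Y̲̲[μ_N]` is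
`Im(s^Θ_Ÿ)` for the theta section built from `η` — abc-iut-L2-t11's `map_range_sCupPi` with `H`, `hY`, `hχ`, `hYdd`, `h1` (F-0542), `hcs` (F-0543)
supplied BY NAME.  [cite: MochizukiEtTh2009, Prop 5.2 (iii) p.324 (PDF p.98); Lem 5.9 (iv) p.332 (PDF p.106)] -/
theorem map_range_sCupPi_ofThetaSettingYdd_of_thetaSectionCompat
    {η : (C.thetaEnvData μ hC hS).PiYdd → (C.thetaEnvData μ hC hS).mu} (hη : η ∈ (C.thetaEnvData μ hC hS).thetaCocycles)
    (hcompat : (ofThetaSettingData μ hC hS h Q R K' constEmb constEmb_injective hinvc hinvp).ThetaSectionCompat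
      (facts_ofThetaSettingYddData_of_constantsDictionary (hD' := hD)) (C.thetaEnvData μ hC hS)
      (ContinuousMulEquiv.refl _).toMulEquiv m
      (identifiesPiYdd_ofThetaSettingData' μ hC hS h Q R K' constEmb constEmb_injective hinvc hinvp) η) :
    ((ofThetaSettingData μ hC hS h Q R K' constEmb constEmb_injective hinvc hinvp).sCupPi
          (facts_ofThetaSettingYddData_of_constantsDictionary (hD' := hD)).sectionsFactor
          (facts_ofThetaSettingYddData_of_constantsDictionary (hD' := hD)).sgpCupSection).range.map
        ((ofThetaSettingData μ hC hS h Q R K' constEmb constEmb_injective hinvc hinvp).envIso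
          (facts_ofThetaSettingYddData_of_constantsDictionary (hD' := hD)) (C.thetaEnvData μ hC hS)
          (ContinuousMulEquiv.refl _).toMulEquiv m
          (identifiesPiY_ofThetaSettingData μ hC hS h Q R K' constEmb constEmb_injective hinvc hinvp)
          (hD.cyclotomicCharacterCompatX
            (kxRootNModCyclotome_ofThetaSettingData_of_constantsDictionary μ hC hS h Q R K' constEmb constEmb_injective hinvc hinvp
              hconst m hD)).toY).toMonoidHom =
      ((C.thetaEnvData μ hC hS).sTheta hη).range :=
  (ofThetaSettingData μ hC hS h Q R K' constEmb constEmb_injective hinvc hinvp).map_range_sCupPi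
    (facts_ofThetaSettingYddData_of_constantsDictionary (hD' := hD)) (C.thetaEnvData μ hC hS) (ContinuousMulEquiv.refl _).toMulEquiv m
    (identifiesPiY_ofThetaSettingData μ hC hS h Q R K' constEmb constEmb_injective hinvc hinvp)
    (hD.cyclotomicCharacterCompatX
      (kxRootNModCyclotome_ofThetaSettingData_of_constantsDictionary μ hC hS h Q R K' constEmb constEmb_injective hinvc hinvp
        hconst m hD)).toY
    (identifiesPiYdd_ofThetaSettingData' μ hC hS h Q R K' constEmb constEmb_injective hinvc hinvp)
    (facts_ofThetaSettingYddData_of_constantsDictionary (hD' := hD)).sectionsFactor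
    (facts_ofThetaSettingYddData_of_constantsDictionary (hD' := hD)).sgpCupSection hη hcompat

/-- **Prop. 5.2 (iii) / Lemma 5.9 (iv) at the Ÿ̲̲-junction data, the `s^Θ`-clause of the isomorphism of bi-theta environments — `[Im s^⊔-Π_N] ↦
[Im s^Θ_Ÿ]` at the level of `μ_N`-conjugacy classes — MODULO THE PROP. 5.2 (iii) ORIGIN CLAUSE**: for `η :=` the transported bi-Kummer difference
cocycle `k ↦ m(d(k))⁻¹` (F-0521 in SOLVED FORM, abc-iut-f-125 / f-116 `thetaSectionCompat_ofThetaSettingData_transport`) and the ONE clause `hΘ` «that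
cocycle lies in `C.thetaCocycles hC μ`» (GAP G-L2t4-2, pin `θ := Θ̈`): abc-iut-L2-t11's `map_sTheta_eq` with every law binder and `H`, `hY`, `hYdd`,
`hχX` supplied BY NAME, at the honest `DK`.  [cite: MochizukiEtTh2009, Prop 5.2 (iii) p.324 (PDF p.98); Lem 5.9 (iv) p.332 (PDF p.106)] -/
theorem map_sTheta_eq_ofThetaSettingYdd_of_originClause
    (hΘ : (fun k : (C.thetaEnvData μ hC hS).PiYdd =>
        (m ((ofThetaSettingData μ hC hS h Q R K' constEmb constEmb_injective hinvc hinvp).diffCocycle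
          (facts_ofThetaSettingYddData_of_constantsDictionary (hD' := hD)) k))⁻¹) ∈ C.thetaCocycles hC μ) :
    (fun L : Subgroup (ofThetaSettingData μ hC hS h Q R K' constEmb constEmb_injective hinvc hinvp).EPiN =>
        L.map ((ofThetaSettingData μ hC hS h Q R K' constEmb constEmb_injective hinvc hinvp).envContIso
          (facts_ofThetaSettingYddData_of_constantsDictionary (hD' := hD)) (C.thetaEnvData μ hC hS) (ContinuousMulEquiv.refl _) m
          (identifiesPiY_ofThetaSettingData μ hC hS h Q R K' constEmb constEmb_injective hinvc hinvp)
          (hD.cyclotomicCharacterCompatX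
            (kxRootNModCyclotome_ofThetaSettingData_of_constantsDictionary μ hC hS h Q R K' constEmb constEmb_injective hinvc hinvp
              hconst m hD)).toY).toMulEquiv.toMonoidHom) ''
      ((ofThetaSettingData μ hC hS h Q R K' constEmb constEmb_injective hinvc hinvp).frdBiThetaEnv
        (facts_ofThetaSettingYddData_of_constantsDictionary (hD' := hD)).sectionsFactor
        (ofThetaSettingData μ hC hS h Q R K' constEmb constEmb_injective hinvc hinvp).outerActionLZ_of
        (facts_ofThetaSettingYddData_of_constantsDictionary (hD' := hD)).sgpCapSection
        (facts_ofThetaSettingYddData_of_constantsDictionary (hD' := hD)).sgpCupSection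
        (facts_ofThetaSettingYddData_of_constantsDictionary (hD' := hD)).constantsEqNormalizer
        (dkOfConnectedTemperoidData (T := C.thetaEnvData μ hC hS) h Q C.odd_lPNat R (ContinuousMulEquiv.refl _) K' constEmb
          constEmb_injective hinvc hinvp hconst
          (kxRootNModCyclotome_ofThetaSettingData_of_constantsDictionary μ hC hS h Q R K' constEmb constEmb_injective hinvc hinvp hconst
            m hD))).sTheta =
      CycEnvelope.muConjClass (C.thetaEnvData μ hC hS).augY (C.thetaEnvData μ hC hS).chi ((C.thetaEnvData μ hC hS).sTheta hΘ).range :=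
  (ofThetaSettingData μ hC hS h Q R K' constEmb constEmb_injective hinvc hinvp).map_sTheta_eq
    (facts_ofThetaSettingYddData_of_constantsDictionary (hD' := hD))
    (facts_ofThetaSettingYddData_of_constantsDictionary (hD' := hD)).sectionsFactor
    (ofThetaSettingData μ hC hS h Q R K' constEmb constEmb_injective hinvc hinvp).outerActionLZ_of
    (facts_ofThetaSettingYddData_of_constantsDictionary (hD' := hD)).sgpCapSection
    (facts_ofThetaSettingYddData_of_constantsDictionary (hD' := hD)).sgpCupSection
    (facts_ofThetaSettingYddData_of_constantsDictionary (hD' := hD)).constantsEqNormalizer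
    (dkOfConnectedTemperoidData (T := C.thetaEnvData μ hC hS) h Q C.odd_lPNat R (ContinuousMulEquiv.refl _) K' constEmb
      constEmb_injective hinvc hinvp hconst
      (kxRootNModCyclotome_ofThetaSettingData_of_constantsDictionary μ hC hS h Q R K' constEmb constEmb_injective hinvc hinvp hconst m hD))
    (C.thetaEnvData μ hC hS) (ContinuousMulEquiv.refl _) m
    (identifiesPiY_ofThetaSettingData μ hC hS h Q R K' constEmb constEmb_injective hinvc hinvp)
    (identifiesPiYdd_ofThetaSettingData' μ hC hS h Q R K' constEmb constEmb_injective hinvc hinvp)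
    (hD.cyclotomicCharacterCompatX
      (kxRootNModCyclotome_ofThetaSettingData_of_constantsDictionary μ hC hS h Q R K' constEmb constEmb_injective hinvc hinvp
        hconst m hD))
    hΘ (thetaSectionCompat_ofThetaSettingData_transport μ hC hS h Q R K' constEmb constEmb_injective hinvc hinvp
      (facts_ofThetaSettingYddData_of_constantsDictionary (hD' := hD)) m)

end EnvIsoChain

end ThetaFrobenioid

end Literature.AnabelianGeometry.EtaleTheta

end
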